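import Summits.QuantumFields.YangMills.Theses.UnitScaleTilt
import Literature.MathematicalPhysics.QuantumFieldTheory.Balaban1983to89.T3CruxEstimates

/-!
# Route `UnitScaleTilt` — crux K1 `UnitTilt` (stmt-QuantumFields-18915) REDUCED TO ONE ESTIMATE IN BAŁABAN'S CURRENCY
# (support file; K1 itself stays open)

Cell `ym3-torus` (HUMAN RULING D-0037, YM ladder rung R3), seat `ym3-torus-p2` gen 3.  `unitScaleTilt_unitTilt_of_heightSandwich`:
K1 ⇐ for every `L` some `m > 0` such that for every profile `(b₀, p₀)`, below a threshold `γ₁`, every family with `F.L = L` and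
`0 < γ ≤ γ₁` satisfies `T3CruxEstimates.HeightSandwichAt F γ b₀ p₀ m` — the almost-everywhere two-run sandwich, modulo FREE constants,
of the FULLY-CONSTRAINED restricted renormalised densities of the two consecutive approximations at the comparison scale
`η = L^{-⌊K/m⌋}` with summable radii (tree chain `unitTiltAt_of_heightSandwichAt` ← `T3TiltDescent.unitTiltAt_of_heightSandwich`:
`A_K = A_n ∘ D_{n,K}`, tilts push forward under every measurable map, `(D_{n,K})_*(Gibbs_K|S) = Haar.withDensity(Z_K⁻¹ρ^S_{K−n})`).
[Balaban1985UV3] (41) is the one-run envelope of exactly these densities; [King1986] Thm 3.4 the abelian two-cut-off template.  The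
further split into one-run envelopes + an effective-action comparison is `T3HeightSandwichSplit.heightSandwichAt_of_envelopes`.
NOT a proof of K1.
-/

noncomputable section

open Literature.MathematicalPhysics.QuantumFieldTheory.Balaban1983to89
open Literature.MathematicalPhysics.QuantumFieldTheory.Balaban1983to89.T3ContinuumYM3Torus
open Literature.MathematicalPhysics.QuantumFieldTheory.Balaban1983to89.T3UnitScaleTilt
open Literature.MathematicalPhysics.QuantumFieldTheory.Balaban1983to89.T3CruxEstimates
open Summit.QuantumFields.YangMills.Theses.UnitScaleTilt

namespace Summit.QuantumFields.YangMills.Theorems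

/-- **K1 ⇐ ONE ESTIMATE** (`T3CruxEstimates.HeightSandwichAt` under the route's quantifier prefix): the two-run sandwich of Bałaban's
fully-constrained restricted densities at the comparison height, with summable radii and free constants, for every `K`, gives
`UnitTilt` (`γ ≥ 0` suffices in the reduction; the route asks `0 < γ ≤ γ₁`). -/
theorem unitScaleTilt_unitTilt_of_heightSandwich
    (h : ∀ L : ℕ, ∃ m : ℕ, 0 < m ∧ ∀ b₀ p₀ : ℝ, 0 < b₀ → 2 < p₀ → ∃ γ₁ : ℝ, 0 < γ₁ ∧
      ∀ (F : T3Family) (γ : ℝ), F.L = L → 0 < γ → γ ≤ γ₁ → HeightSandwichAt F γ b₀ p₀ m) :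
    UnitTilt := by
  intro L
  obtain ⟨m, hm, h⟩ := h L
  refine ⟨m, hm, fun b₀ p₀ hb hp => ?_⟩
  obtain ⟨γ₁, hγ₁, h⟩ := h b₀ p₀ hb hp
  exact ⟨γ₁, hγ₁, fun F γ hL hγ hle => unitTiltAt_of_heightSandwichAt F hγ.le (h F γ hL hγ hle)⟩

end Summit.QuantumFields.YangMills.Theorems

end
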